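import Mathlib
import HarnessLib
import Summits.NavierStokesRegularity.NavierStokesRegularity.Theorems.ChiralWindowDoorDefs
import Summits.NavierStokesRegularity.NavierStokesRegularity.Theorems.ChiralWindowDoorClassDerivDecay
import Summits.NavierStokesRegularity.NavierStokesRegularity.Theorems.ChiralWindowDoorGagliardoIdentity
import Summits.NavierStokesRegularity.NavierStokesRegularity.Theorems.ChiralWindowDoorLocalHelicityLower

/-!
# Door S21-C «CriticalFluxDoor» (nsreg-p1 ROUND-20, design-only) — stub F1 `stub_critEnergyLower` PROVED: the windowed
# critical energy `Q(a_R, v) = ∫ a_R ⟪v, Λv⟫` of a door-class slice is almost coercive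

Door S21-C of nsreg-p1's local Type-I door family (`HOME/ns-regularity-ideate-p1/ROUND-20.md`, texts `r20/Sketch21v3.lean`;
DESIGN-ONLY, route NOT born).  PROOF BY nsreg-p1 g18 (`HOME/ns-regularity-ideate-p1/r20/F1Proved.lean`, farm rc 0),
landed by the prover seat with the windowed critical energy `critEnergy (bumpSq η R) (v t)` δ-UNFOLDED to
`∫ a_R ⟪v t, Λ(v t)⟫` (the S21-C substrate `…CriticalFluxDoorDefs` is in the definition review queue; once it lands the
verbatim text is `critEnergy_eq ▸` this theorem).  It is S20's B1′ (`…LocalHelicityLower.localHelicityLower`) with the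
chirality rewrite `Λv = curl v` omitted: the untruncated Gagliardo–`Λ` identity
`G(a,f) ≤ ∫a⟪f,Λf⟫ + ½∫‖f‖²|Λa|` (`…GagliardoIdentity.gagliardo_le_integral_add`) plus the scale-invariant decay
bookkeeping `½∫‖v‖²|Λ a_R| ≤ ½D²c₁(η)`, with the derivative binder supplied by `…ClassDerivDecay.derivDecay_of_class`.

* `critEnergyLower` — F1 (binder-free): `∃ c, ∀ R > 0, ∀ t < 0, G(a_R, v t) ≤ ∫ a_R ⟪v t, Λ v t⟫ + c`;
* `critEnergy_ge_neg_const` — corollary `∫ a_R ⟪v t, Λ v t⟫ ≥ −c`.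

Seat nsreg-p6 g12 (THEOREMS-ONLY door sequels, DIRECTOR-NS g8 #32 (2)/#36); proof text nsreg-p1 g18.  WHAT THIS IS
NOT: not NS regularity (Clay A); not S21-C's F2/F3/K1/K2; no route is opened.
-/

noncomputable section

-- the summit and its single sub-problem share the name (CONVENTIONS §1), as in every Theorems file
set_option linter.dupNamespace false

namespace Summit.NavierStokesRegularity.NavierStokesRegularity.Theorems.CriticalFluxDoorCritEnergyLower

open Set Function MeasureTheory Metric
open scoped RealInnerProductSpace
open Literature.Analysis Literature.Analysis.FluidPDE
open Summit.NavierStokesRegularity.NavierStokesRegularity.Theorems.ChiralWindowDoorDefs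
open Summit.NavierStokesRegularity.NavierStokesRegularity.Theorems.ChiralWindowDoorClassDerivDecay
open Summit.NavierStokesRegularity.NavierStokesRegularity.Theorems.ChiralWindowDoorGagliardoIdentity
open Summit.NavierStokesRegularity.NavierStokesRegularity.Theorems.ChiralWindowDoorLocalHelicityLower

/-- **F1 `stub_critEnergyLower` of nsreg-p1 `r20/Sketch21v3.lean` (with `critEnergy` δ-unfolded), PROVED (nsreg-p1 g18,
`r20/F1Proved.lean`, kernel rc 0; landed here): the windowed critical energy of a
door-class slice is almost coercive, `G(a_R, v t) ≤ Q(a_R, v t) + c` with `c = ½ D² c₁(η)` independent of `R > 0`, `t < 0`. -/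
theorem critEnergyLower : ∀ (η : EuclideanSpace ℝ (Fin 3) → ℝ), IsAdmissibleBump η → ∀ (C D : ℝ) (v : ℝ → EuclideanSpace ℝ (Fin 3) → EuclideanSpace ℝ (Fin 3)),
    HasTypeITimeDecay C v → HasTypeIDecay D v →
    ContinuousOn (Function.uncurry v) (Set.Iio (0 : ℝ) ×ˢ Set.univ) →
    (∀ s t : ℝ, s < t → t < 0 → ∀ x,
        v t x = UnboundedOperators.heatExtension (v s) (t - s) x - oseenDuhamel 1 s v v t x) →
    (∀ t < 0, VectorCalculus.IsDivFree (v t)) →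
    ∃ c : ℝ, ∀ R > (0 : ℝ), ∀ t < (0 : ℝ), gagliardo (bumpSq η R) (v t) ≤ (∫ x, bumpSq η R x * ⟪v t x, fracLapHalf (v t) x⟫) + c := by
  intro η hη C D v hrate hdecay hcont hmild hdiv
  -- the derivative binder is FREE for the class (p6 g10)
  obtain ⟨K, hK⟩ := derivDecay_of_class C D v hrate hdecay hcont hmild hdiv
  have hder : HasTypeIDerivDecay K v := hK
  -- `0 ≤ D` (evaluate the decay bound anywhere)
  have hD : 0 ≤ D := by
    have h := hdecay (-1) (by norm_num) 0
    have hpos : 0 < ‖(0 : EuclideanSpace ℝ (Fin 3))‖ + Real.sqrt (-(-1 : ℝ)) := by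
      rw [norm_zero, zero_add]; exact Real.sqrt_pos.2 (by norm_num)
    by_contra hD
    push Not at hD
    have : D / (‖(0 : EuclideanSpace ℝ (Fin 3))‖ + Real.sqrt (-(-1 : ℝ))) < 0 := div_neg_of_neg_of_pos hD hpos
    linarith [norm_nonneg (v (-1) 0)]
  set c₁ : ℝ := ∫ y : EuclideanSpace ℝ (Fin 3), ‖y‖ ^ (-(2 : ℝ)) * |fracLapHalfS (bumpSq η 1) y| with hc₁
  refine ⟨(1 / 2 : ℝ) * (D ^ 2 * c₁), fun R hR t ht => ?_⟩
  -- the weight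
  have hac : Continuous (bumpSq η R) := continuous_bumpSq hη R
  have hann : ∀ x, 0 ≤ bumpSq η R x := bumpSq_nonneg η R
  have ha0 : ∀ x, |bumpSq η R x| ≤ 1 := fun x => by
    rw [abs_of_nonneg (hann x)]; exact bumpSq_le_one hη R x
  obtain ⟨A₂, hA₂⟩ := exists_secondDiff_bound_bumpSq hη hR
  have hρ : 0 < 2 * R := by positivity
  have hsupp : ∀ x : EuclideanSpace ℝ (Fin 3), 2 * R ≤ ‖x‖ → bumpSq η R x = 0 := fun x hx => bumpSq_eq_zero hη hR hx
  -- the slice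
  obtain ⟨_, hfc, hf0, hf1, hf2⟩ := slice_regularity hrate hder hcont hmild ht
  -- the identity in inequality form: its first term IS `critEnergy (bumpSq η R) (v t)`
  have hG := gagliardo_le_integral_add hac hann ha0 hA₂ hρ hsupp hfc hf0 hf1 hf2
  -- decay bookkeeping
  have hdec' : ∀ x : EuclideanSpace ℝ (Fin 3), x ≠ 0 → ‖v t x‖ ≤ D / ‖x‖ := fun x hx => by
    have hxpos : 0 < ‖x‖ := norm_pos_iff.2 hx
    refine (hdecay t ht x).trans (div_le_div_of_nonneg_left hD hxpos ?_)
    linarith [Real.sqrt_nonneg (-t)]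
  have hbook := integral_normSq_mul_abs_fracLapHalfS_le hη hdec' hR (f := v t)
  calc gagliardo (bumpSq η R) (v t)
      ≤ (∫ x, bumpSq η R x * ⟪v t x, fracLapHalf (v t) x⟫) + (1 / 2 : ℝ) * ∫ x, ‖v t x‖ ^ 2 * |fracLapHalfS (bumpSq η R) x| := hG
    _ ≤ (∫ x, bumpSq η R x * ⟪v t x, fracLapHalf (v t) x⟫) + (1 / 2 : ℝ) * (D ^ 2 * c₁) := by
        gcongr

/-- **Corollary: the windowed critical energy of a door-class profile is almost non-negative**, `Q(a_R, v t) ≥ −c`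
uniformly in `R > 0`, `t < 0` (F1 and `gagliardo ≥ 0`) — the lower bound used on the LEFT of the budget F3. -/
theorem critEnergy_ge_neg_const : ∀ (η : EuclideanSpace ℝ (Fin 3) → ℝ), IsAdmissibleBump η → ∀ (C D : ℝ)
    (v : ℝ → EuclideanSpace ℝ (Fin 3) → EuclideanSpace ℝ (Fin 3)),
    HasTypeITimeDecay C v → HasTypeIDecay D v →
    ContinuousOn (Function.uncurry v) (Set.Iio (0 : ℝ) ×ˢ Set.univ) →
    (∀ s t : ℝ, s < t → t < 0 → ∀ x,
        v t x = UnboundedOperators.heatExtension (v s) (t - s) x - oseenDuhamel 1 s v v t x) →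
    (∀ t < 0, VectorCalculus.IsDivFree (v t)) →
    ∃ c : ℝ, ∀ R > (0 : ℝ), ∀ t < (0 : ℝ), -c ≤ (∫ x, bumpSq η R x * ⟪v t x, fracLapHalf (v t) x⟫) := by
  intro η hη C D v hrate hdecay hcont hmild hdiv
  obtain ⟨c, hc⟩ := critEnergyLower η hη C D v hrate hdecay hcont hmild hdiv
  refine ⟨c, fun R hR t ht => ?_⟩
  have h := hc R hR t ht
  have hG : 0 ≤ gagliardo (bumpSq η R) (v t) := gagliardo_nonneg (bumpSq_nonneg η R) _
  linarith

end Summit.NavierStokesRegularity.NavierStokesRegularity.Theorems.CriticalFluxDoorCritEnergyLower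

end
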